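import Literature.NumberTheory.LFunctions.RosserSchoenfeldMertensFirstConstant
import HarnessLib

/-!
# Rosser–Schoenfeld 1962: corollaries of the identification of `E` (Thm. 6 for large `x`, `E < −1`)

Literature/NumberTheory/LFunctions. THEOREMS only (no definition, no named fact), continuing
`RosserSchoenfeldMertensFirstConstant.lean`, which identifies the constant
`E = −γ − Σ_p (log p)/(p(p−1))` (`rosserSchoenfeldE`, RS62 (2.8)) with the constant of Mertens'
first theorem and proves (2.5), (4.21) and the large-`x` glue of Theorem 6 from a `θ`-bound
(J. B. Rosser, L. Schoenfeld, *Approximate formulas for some functions of prime numbers*, Illinois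
J. Math. 6 (1962), 64–94). Recorded here:

* `tendsto_sum_vonMangoldt_div_sub_log` — **`Σ_{n ≤ x} Λ(n)/n − log x → −γ`**, the `Λ`-form of
  Mertens' first theorem with its constant: RS62 (2.8) says exactly that the two limits differ by
  `Σ_{n ≥ 2} Σ_p (log p)/pⁿ = Σ_p (log p)/(p(p−1))` (the tree's explicit companion is
  `Literature.NumberTheory.Sieve.SelbergSymmetry.abs_sum_vonMangoldt_div_sub_log_le`, `|…| ≤ 6`);
* `rosserSchoenfeldE_lt_neg_one`, `rosserSchoenfeldE_neg` — `E < −1 < 0` (crudely, from `γ > 1/2`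
  and the primes `2, 3`; RS62 (2.11): `E = −1.33258 22757…`);
* `RosserSchoenfeld1962_thm6_eventually` — **Theorem 6, (3.21)–(3.22), for all sufficiently large
  `x`** (an ineffective threshold, from the log-square rate of
  `abs_sum_primesLE_log_div_sub_log_sub_rosserSchoenfeldE_le`);
* `RosserSchoenfeld1962_eq_3_21_of_two_le` — the range `1 < x < 2` of (3.21) is free (empty sum,
  `log x + E − 1/(2 log x) < 0`), so the named fact `RosserSchoenfeld1962_eq_3_21` reduces to
  `x ≥ 2`; `RosserSchoenfeld1962_eq_3_21_of_theta` — hence (3.21) from a `θ`-bound on `y ≥ 2`.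

What remains for the named facts (3.21)–(3.22) themselves is unchanged: an unconditional explicit
bound `|θ(y) − y| ≤ η y/log² y` (`η (1 + 1/log X) < 1/2`, feeding
`RosserSchoenfeld1962_thm6_of_theta`) — Rosser–Schoenfeld's §6 and Table I — and the tabulated
range below `X` (their Thm. 21 to `10⁸`).

## References
* J. B. Rosser, L. Schoenfeld, Illinois J. Math. 6 (1962), 64–94: (2.5), (2.8), (2.11), Thm. 6
  (3.21)–(3.22), p. 70; proof of Thms. 5–6, §8 p. 87. [RosserSchoenfeld1962]
* H. L. Montgomery, R. C. Vaughan, *Multiplicative Number Theory I*, CUP 2007, Thm. 2.7 (a)–(b) and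
  §6.2 (the constants of Thm. 2.7 with the de la Vallée Poussin error term). [MontgomeryVaughan2007]
-/

noncomputable section

open Filter Topology

open scoped Chebyshev ArithmeticFunction.vonMangoldt

namespace Literature.NumberTheory.LFunctions

/-! ### `Σ_{n ≤ x} Λ(n)/n − log x → −γ` -/

/-- `Σ_{n ≤ N} Λ(n)/n = Σ_{p ≤ N} (log p)/p + Σ_{1 < n ≤ N, n not prime} Λ(n)/n` (the term `n = 1`
vanishes). [folklore] -/
theorem RosserSchoenfeld.sum_vonMangoldt_div_eq_add (N : ℕ) :
    ∑ n ∈ Finset.Ioc 0 N, Λ n / n =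
      (∑ p ∈ Nat.primesLE N, Real.log p / p) +
        ∑ k ∈ Finset.Ioc 1 N, (if k.Prime then 0 else (Λ k : ℝ)) / k := by
  have hsplit : ∑ n ∈ Finset.Ioc 0 N, Λ n / n =
      (∑ n ∈ Finset.Ioc 0 N, if n.Prime then Real.log n / n else 0) +
        ∑ n ∈ Finset.Ioc 0 N, (if n.Prime then 0 else (Λ n : ℝ)) / n := by
    rw [← Finset.sum_add_distrib]
    refine Finset.sum_congr rfl fun n _ ↦ ?_
    by_cases hp : n.Prime
    · simp [hp, ArithmeticFunction.vonMangoldt_apply_prime hp]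
    · simp [hp]
  have hprimes : (∑ n ∈ Finset.Ioc 0 N, if n.Prime then Real.log n / n else 0) =
      ∑ p ∈ Nat.primesLE N, Real.log p / p := by
    rw [Nat.primesLE_eq_filter_Ioc_zero, Finset.sum_filter]
  have htail : ∑ n ∈ Finset.Ioc 0 N, (if n.Prime then 0 else (Λ n : ℝ)) / n =
      ∑ k ∈ Finset.Ioc 1 N, (if k.Prime then 0 else (Λ k : ℝ)) / k := by
    rcases Nat.eq_zero_or_pos N with rfl | hN
    · simp
    · rw [← Finset.sum_Ioc_consecutive _ (Nat.zero_le 1) hN]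
      have h1 : Finset.Ioc 0 1 = {1} := by decide
      simp [h1, Nat.not_prime_one, ArithmeticFunction.vonMangoldt_apply_one]
  rw [hsplit, hprimes, htail]

/-- **`Σ_{n ≤ x} Λ(n)/n − log x → −γ`** (`x → ∞`): by RS62 (2.5) with (2.8),
`Σ_{p ≤ x} (log p)/p − log x → E = −γ − Σ_p (log p)/(p(p−1))`, and the prime powers `pᵏ`, `k ≥ 2`,
contribute `Σ_{n ≤ x, n not prime} Λ(n)/n → Σ_p (log p)/(p(p−1))`. (Montgomery–Vaughan Thm. 2.7 (a)
with its constant; the tree's explicit two-sided bound is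
`Literature.NumberTheory.Sieve.SelbergSymmetry.abs_sum_vonMangoldt_div_sub_log_le`.)
[cite: RosserSchoenfeld1962, (2.5) and (2.8)] -/
theorem tendsto_sum_vonMangoldt_div_sub_log :
    Tendsto (fun x : ℝ ↦ ∑ n ∈ Finset.Ioc 0 ⌊x⌋₊, Λ n / n - Real.log x) atTop
      (𝓝 (-Real.eulerMascheroniConstant)) := by
  have h1 := tendsto_sum_primesLE_log_div_sub_log
  have h2 := RosserSchoenfeld.tendsto_sum_vonMangoldt_nonPrime_div
  have hS : ∑' n : ℕ, (if n.Prime then 0 else (Λ n : ℝ)) / n =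
      -Real.eulerMascheroniConstant - rosserSchoenfeldE := by
    rw [RosserSchoenfeld.tsum_vonMangoldt_nonPrime_div]
    exact hasSum_primes_log_div_mul_pred.tsum_eq
  have h := h1.add h2
  rw [hS, show rosserSchoenfeldE + (-Real.eulerMascheroniConstant - rosserSchoenfeldE) =
    -Real.eulerMascheroniConstant by ring] at h
  refine h.congr fun x ↦ ?_
  rw [RosserSchoenfeld.sum_vonMangoldt_div_eq_add ⌊x⌋₊]
  ring

/-! ### `E < −1` -/

/-- `E < −1`: `γ > 1/2` and already the primes `2, 3` give
`Σ_p (log p)/(p(p−1)) ≥ (log 2)/2 + (log 3)/6 > 0.34 + 0.16` (in fact `E = −1.33258…`,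
RS62 (2.11)). [cite: RosserSchoenfeld1962, (2.11)] -/
theorem rosserSchoenfeldE_lt_neg_one : rosserSchoenfeldE < -1 := by
  have hγ := Real.one_half_lt_eulerMascheroniConstant
  have hsum := hasSum_primes_log_div_mul_pred
  set f : Nat.Primes → ℝ := fun p ↦ Real.log (p : ℝ) / ((p : ℝ) * ((p : ℝ) - 1)) with hf
  have hf0 : ∀ p, 0 ≤ f p := fun p ↦ by
    have hp2 : (2 : ℝ) ≤ p := by exact_mod_cast p.2.two_le
    exact div_nonneg (Real.log_nonneg (by linarith)) (by nlinarith)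
  let p2 : Nat.Primes := ⟨2, Nat.prime_two⟩
  let p3 : Nat.Primes := ⟨3, Nat.prime_three⟩
  have hne : p2 ≠ p3 := by decide
  have hle : ∑ p ∈ ({p2, p3} : Finset Nat.Primes), f p ≤
      -Real.eulerMascheroniConstant - rosserSchoenfeldE := by
    rw [← hsum.tsum_eq]
    exact hsum.summable.sum_le_tsum _ fun p _ ↦ hf0 p
  rw [Finset.sum_pair hne] at hle
  have h2 : f p2 = Real.log 2 / 2 := by simp [hf, p2]; norm_num
  have h3 : f p3 = Real.log 3 / 6 := by simp [hf, p3]; norm_num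
  have hlog2 := Real.log_two_gt_d9
  have hlog3 : 1 < Real.log 3 := by
    rw [Real.lt_log_iff_exp_lt (by norm_num)]
    have := Real.exp_one_lt_d9
    linarith
  linarith

/-- `E < 0`. [cite: RosserSchoenfeld1962, (2.11)] -/
theorem rosserSchoenfeldE_neg : rosserSchoenfeldE < 0 := by
  linarith [rosserSchoenfeldE_lt_neg_one]

/-! ### Theorem 6 for large `x`, and the trivial range `1 < x < 2` of (3.21) -/

/-- **RS62 Theorem 6, (3.21)–(3.22), for all sufficiently large `x`** (ineffective threshold):
from `|Σ_{p ≤ x} (log p)/p − log x − E| ≤ K/log² x < 1/(2 log x)` once `log x > 2K`.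
[cite: RosserSchoenfeld1962, Thm. 6 (3.21)–(3.22)] -/
theorem RosserSchoenfeld1962_thm6_eventually :
    ∃ X : ℝ, ∀ x : ℝ, X ≤ x →
      Real.log x + rosserSchoenfeldE - 1 / (2 * Real.log x) <
          ∑ p ∈ Nat.primesLE ⌊x⌋₊, Real.log p / p ∧
        ∑ p ∈ Nat.primesLE ⌊x⌋₊, Real.log p / p <
          Real.log x + rosserSchoenfeldE + 1 / (2 * Real.log x) := by
  obtain ⟨K, hK⟩ := abs_sum_primesLE_log_div_sub_log_sub_rosserSchoenfeldE_le 2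
  refine ⟨max 2 (Real.exp (2 * K + 1)), fun x hx ↦ ?_⟩
  have hx2 : 2 ≤ x := (le_max_left _ _).trans hx
  have hxe : Real.exp (2 * K + 1) ≤ x := (le_max_right _ _).trans hx
  have hl : 2 * K + 1 ≤ Real.log x := by
    rw [← Real.log_exp (2 * K + 1)]
    exact Real.log_le_log (Real.exp_pos _) hxe
  have hl0 : 0 < Real.log x := Real.log_pos (by linarith)
  have h := hK x hx2
  rw [abs_le] at h
  have hbound : K / Real.log x ^ 2 < 1 / (2 * Real.log x) := by
    rw [div_lt_div_iff₀ (by positivity) (by positivity)]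
    nlinarith
  constructor <;> nlinarith [h.1, h.2]

/-- **The range `1 < x < 2` of (3.21) is free**: there the sum is empty and
`log x + E − 1/(2 log x) < log 2 − 1 < 0`; so (3.21) for all `x > 1` follows from (3.21) for
`x ≥ 2`.
[cite: RosserSchoenfeld1962, Thm. 6 (3.21)] -/
theorem RosserSchoenfeld1962_eq_3_21_of_two_le
    (h : ∀ x : ℝ, 2 ≤ x →
      Real.log x + rosserSchoenfeldE - 1 / (2 * Real.log x) <
        ∑ p ∈ Nat.primesLE ⌊x⌋₊, Real.log p / p) :
    RosserSchoenfeld1962_eq_3_21 := by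
  intro x hx
  by_cases h2 : 2 ≤ x
  · exact h x h2
  · push Not at h2
    have hfl : ⌊x⌋₊ = 1 := by
      rw [Nat.floor_eq_iff (by linarith)]
      constructor
      · exact_mod_cast hx.le
      · push_cast; linarith
    rw [hfl, Nat.primesLE_one, Finset.sum_empty]
    have hl0 : 0 < Real.log x := Real.log_pos hx
    have hl2 : Real.log x < Real.log 2 := Real.log_lt_log (by linarith) h2
    have hlog2 := Real.log_two_lt_d9
    have hE := rosserSchoenfeldE_lt_neg_one
    have hpos : 0 < 1 / (2 * Real.log x) := by positivity
    linarith

/-- **(3.21) for all `x > 1` from a `θ`-bound covering `y ≥ 2`**: if `|θ(y) − y| ≤ η y/log² y` for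
all `y ≥ 2` with `η (1 + 1/log 2) < 1/2` — the shape of the input Rosser–Schoenfeld take from their
§§5–6 (for `x ≥ 10⁸`) and tables (below) — then the named fact `RosserSchoenfeld1962_eq_3_21` holds.
(A glue theorem; its hypothesis is not available in the tree.)
[cite: RosserSchoenfeld1962, Thm. 6 (3.21), proof (§8, p. 87)] -/
theorem RosserSchoenfeld1962_eq_3_21_of_theta {η : ℝ} (hη : 0 ≤ η)
    (hθ : ∀ y : ℝ, 2 ≤ y → |θ y - y| ≤ η * y / Real.log y ^ 2)
    (hsmall : η * (1 + 1 / Real.log 2) < 1 / 2) :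
    RosserSchoenfeld1962_eq_3_21 :=
  RosserSchoenfeld1962_eq_3_21_of_two_le fun _ hx ↦
    (RosserSchoenfeld1962_thm6_of_theta le_rfl hη hθ hsmall hx).1

end Literature.NumberTheory.LFunctions
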